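import Summits.BirchSwinnertonDyer.BirchSwinnertonDyer.Theorems.KolyvaginRoadThreeZhangSupplyLocalConjInvolution
import HarnessLib

/-!
# Route `KolyvaginRoadThree`, deciding crux `ZhangSharpFrameAtThreeHL` (item stmt-BirchSwinnertonDyer-19574):
# (E1″) — the local conjugation transport carries the ORDINARY local condition of the method skeleton
# (`WeierstrassCurve.ordinaryLocalKer`, Bertolini–Darmon's `H¹_ord`) at `E` onto the one at `E'`; with the tree's
# `conjAct_mem_selmerLocalKer_iff` (Kummer) and part VI's `conjAct_mem_torsionLocalKer_iff` (strict) this makes the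
# LEVEL-`n` Selmer structure of the skeleton (`Method2Defs.levelSelmerSubgroup` without its sign condition) stable under
# complex conjugation — the `τ`-stability input of part V's signed count
# (cell `bsd-stepL`, ACCEL seat `bsd-stepL-koly3b` g4; `--supports stmt-BirchSwinnertonDyer-19574`, helper; part VIII of the
# (Supply) series; parts VI ∕ VII = `KolyvaginRoadThreeZhangSupplyLocalConj{,Involution}.lean`, p498969 ∕ p499698)

HONEST FRAMING. Theorems only; no definition, no named fact, no `sorry`; nothing at `p = 3 ∥ N`. PARTITION: O2@3 (B10) ×
A1 × crux 19574 — none (engine input; types nothing, closes nothing; T7).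

CONTENT.
* `map_mem_valuedClasses` — functoriality of «classes represented by an `L`-valued cocycle» (`valuedClasses`,
  `OrdinaryLocalCondition.lean`) under a compatible pair `(θ, ψ)`: the image class is represented by the pulled-back
  cocycle `g ↦ ψ(c(θ g))`, valued in `ψ(L)` (Mathlib `ContinuousCohomology.map` on explicit cocycles,
  `map_oneCocycleClass`).
* `map_mem_fixedPoints` — the torsion-level map `ψ` of a lift `Θ` sends `Γ_E`-fixed torsion points to `Γ_{E'}`-fixed
  ones (`ψ (Θ⁻¹gΘ • P) = g • ψ P`).
* `isSemilinearRingEquiv_symm` — `θ⁻¹` is `σ⁻¹`-semilinear; `conjAct_inv_conjAct` — `σ⁻¹_* σ_* = id`.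
* **`conjAct_mem_ordinaryLocalKer_iff`** — for `σ ∈ Aut(K/ℚ)` and a `σ`-semilinear `θ : E ≃+* E'`:
  `σ_* s ∈ ordinaryLocalKer E' n ↔ s ∈ ordinaryLocalKer E n`; **`conjAct_mem_ordinaryLocalKer_adicCompletion_iff`** — the
  case `K_v ≃ K_{σ • v}`. (Bertolini–Darmon 2005 §2.2: `H¹_ord(K_q, E[p])` = classes represented by cocycles valued in
  the `Γ_{K_q}`-fixed torsion, the toric line at a unipotent-admissible `q`; W. Zhang 2014 §4.1.)

What this does NOT do: (E2)–(E4) of part V; the bookkeeping «`levelSelmerSubgroup n S μ` ⊕ `levelSelmerSubgroup n S (¬μ)`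
= the unsigned level group» (now available from the three transport theorems + `Method2Eigen.finrank_eq_eigen_add`).

References: [cite: BertoliniDarmon2005, §2.2 (H¹_ord)] [cite: WZhang2014, §4.1] [cite: SerreGaloisCohomology1997, I §2.4]
[cite: GrossLMS1991, §5 (5.1)].
-/

noncomputable section

open scoped Classical

universe u

namespace Summit.BirchSwinnertonDyer.Rank1Residual.X11b.Three.Koly.ZhangSupply.LocalConj

open CategoryTheory WeierstrassCurve Field Function NumberField IsDedekindDomain
open Literature.NumberTheory.EllipticCurves Literature.NumberTheory.Automorphic
open Literature.NumberTheory.GaloisRepresentations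

/-! ## §1 Valued classes are functorial -/

section Valued

variable {G : Type u} [Group G] [TopologicalSpace G] [IsTopologicalGroup G]
variable {M : Type u} [AddCommGroup M] [DistribMulAction G M] [TopologicalSpace M] [DiscreteTopology M]
variable {H : Type u} [Group H] [TopologicalSpace H] [IsTopologicalGroup H]
variable {N : Type u} [AddCommGroup N] [DistribMulAction H N] [TopologicalSpace N] [DiscreteTopology N]

/-- **Valued classes are functorial.** If `x ∈ H¹(G, M)` is represented by an `L`-valued continuous cocycle and
`(θ : H → G, ψ : M → N)` is a compatible pair with `ψ(L) ⊆ L'`, then the image of `x` in `H¹(H, N)` is represented by the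
`L'`-valued cocycle `g ↦ ψ (c (θ g))` (`map_oneCocycleClass`, `contOneCocycles.pullback`).
[cite: SerreGaloisCohomology1997, I §2.4] -/
theorem map_mem_valuedClasses (θ : H →ₜ* G) (ψ : M →+ N) (h : ∀ (x : H) (m : M), ψ (θ x • m) = x • ψ m)
    {L : AddSubgroup M} {L' : AddSubgroup N} (hL : ∀ m ∈ L, ψ m ∈ L') {x : discreteH1 G M}
    (hx : x ∈ valuedClasses (G := G) L) :
    ContinuousCohomology.map θ (resHomOfEquivariant θ ψ h) 1 x ∈ valuedClasses (G := H) L' := by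
  obtain ⟨c, hc, rfl⟩ := hx
  refine ⟨contOneCocycles.pullback θ (resHomOfEquivariant θ ψ h) c, fun g ↦ ?_,
    (map_oneCocycleClass _ θ (resHomOfEquivariant θ ψ h) c).symm⟩
  rw [contOneCocycles.pullback_apply]
  exact hL _ (hc (θ g))

end Valued

/-! ## §2 Fixed points, the inverse, and the ordinary condition -/

section Transport

variable {K : Type u} [Field K] [CharZero K] (W : WeierstrassCurve ℚ)
variable {E E' : Type u} [Field E] [Algebra K E] [Field E'] [Algebra K E'] [CharZero E] [CharZero E']

/-- The torsion-level map `ψ` of a lift `Θ` sends `Γ_E`-fixed torsion points to `Γ_{E'}`-fixed torsion points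
(`g • ψ P = ψ (Θ⁻¹gΘ • P) = ψ P`). [folklore] -/
theorem map_mem_fixedPoints {θ : E ≃+* E'} {Θ : AlgebraicClosure E ≃+* AlgebraicClosure E'}
    (hΘ : IsLiftOfRingEquiv θ Θ) {n : ℤ}
    (ψ : AddSubgroup.torsionBy (localPoints (W.baseChange K) E) n →+
      AddSubgroup.torsionBy (localPoints (W.baseChange K) E') n)
    (hψ : ∀ P, (ψ P : localPoints (W.baseChange K) E') = localPointsMap (K := K) W Θ P)
    (P : AddSubgroup.torsionBy (localPoints (W.baseChange K) E) n)
    (hP : P ∈ FixedPoints.addSubgroup (absoluteGaloisGroup E)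
      (AddSubgroup.torsionBy (localPoints (W.baseChange K) E) n)) :
    ψ P ∈ FixedPoints.addSubgroup (absoluteGaloisGroup E')
      (AddSubgroup.torsionBy (localPoints (W.baseChange K) E') n) := by
  rw [FixedPoints.mem_addSubgroup] at hP ⊢
  intro g
  rw [← smul_of_coe_eq_localPointsMap W hΘ ψ hψ g P, hP]

omit [CharZero E] [CharZero E'] in
/-- `θ⁻¹` is `σ⁻¹`-semilinear when `θ` is `σ`-semilinear. [folklore] -/
theorem isSemilinearRingEquiv_symm {σ : K ≃ₐ[ℚ] K} {θ : E ≃+* E'} (hθ : IsSemilinearRingEquiv σ θ) :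
    IsSemilinearRingEquiv σ⁻¹ θ.symm := fun x ↦ by
  apply θ.injective
  rw [RingEquiv.apply_symm_apply, hθ]
  congr 1
  change x = σ (σ.symm x)
  exact (σ.apply_symm_apply x).symm

/-- `σ⁻¹_* (σ_* s) = s` on `H¹(K, E[n])` (`conjAct` is multiplicative and `conjAct 1 = id`). [folklore] -/
theorem conjAct_inv_conjAct (σ : K ≃ₐ[ℚ] K) (n : ℤ) (s : galH1Torsion (W.baseChange K) n) :
    conjAct W σ⁻¹ n (conjAct W σ n s) = s := by
  rw [← AddMonoidHom.comp_apply, ← conjAct_mul, inv_mul_cancel, conjAct_one, AddMonoidHom.id_apply]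

/-- **One direction of the transport of the ORDINARY condition**: if `s ∈ ordinaryLocalKer E` (its localisation at
`E` is represented by a cocycle valued in the `Γ_E`-fixed torsion) then `σ_* s ∈ ordinaryLocalKer E'` for a
`σ`-semilinear `θ : E ≃+* E'`: `loc_{E'} (σ_* s) = Φ (loc_E s)` (part VII `transport_torsionLocMap_apply`) and `Φ`
preserves valued classes, the lift's torsion map sending fixed points to fixed points.
[cite: BertoliniDarmon2005, §2.2 (H¹_ord)] [cite: WZhang2014, §4.1] -/
theorem conjAct_mem_ordinaryLocalKer_of_mem (σ : K ≃ₐ[ℚ] K) (θ : E ≃+* E') (hθ : IsSemilinearRingEquiv σ θ)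
    (n : ℤ) {s : galH1Torsion (W.baseChange K) n} (hs : s ∈ (W.baseChange K).ordinaryLocalKer E n) :
    conjAct W σ n s ∈ (W.baseChange K).ordinaryLocalKer E' n := by
  have hΘ : IsLiftOfRingEquiv θ (ringEquivLift θ) := isLiftOfRingEquiv_ringEquivLift θ
  obtain ⟨ψ, hψ⟩ := exists_torsionBy_map (K := K) W (ringEquivLift θ) n
  have h1 := transport_torsionLocMap_apply W σ hθ hΘ n ψ hψ s
  -- unfold the ordinary condition to «`loc` is a valued class»
  change (W.baseChange K).torsionLocMap E' n (conjAct W σ n s) ∈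
    valuedClasses (G := absoluteGaloisGroup E')
      (FixedPoints.addSubgroup (absoluteGaloisGroup E') (AddSubgroup.torsionBy (localPoints (W.baseChange K) E') n))
  change (W.baseChange K).torsionLocMap E n s ∈
    valuedClasses (G := absoluteGaloisGroup E)
      (FixedPoints.addSubgroup (absoluteGaloisGroup E) (AddSubgroup.torsionBy (localPoints (W.baseChange K) E) n)) at hs
  rw [← h1]
  have h2 := map_mem_valuedClasses hΘ.conjGalCMH ψ (smul_of_coe_eq_localPointsMap W hΘ ψ hψ)
    (fun P hP ↦ map_mem_fixedPoints W hΘ ψ hψ P hP) hs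
  simpa only [LinearMap.toAddMonoidHom_coe, ContinuousLinearMap.coe_coe] using h2

/-- **The ORDINARY local condition transports**: `σ_* s ∈ ordinaryLocalKer E' ↔ s ∈ ordinaryLocalKer E` for
`σ ∈ Aut(K/ℚ)` and a `σ`-semilinear `θ : E ≃+* E'` (the converse from `θ⁻¹`, `σ⁻¹` and `σ⁻¹_* σ_* = id`). With the
tree's `conjAct_mem_selmerLocalKer_iff` (Kummer condition) and part VI's `conjAct_mem_torsionLocalKer_iff` (strict
condition), every local condition of the method skeleton's level structures transports under complex conjugation.
[cite: BertoliniDarmon2005, §2.2 (H¹_ord)] [cite: WZhang2014, §4.1] [cite: GrossLMS1991, §5 (5.1)] -/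
theorem conjAct_mem_ordinaryLocalKer_iff (σ : K ≃ₐ[ℚ] K) (θ : E ≃+* E') (hθ : IsSemilinearRingEquiv σ θ) (n : ℤ)
    (s : galH1Torsion (W.baseChange K) n) :
    conjAct W σ n s ∈ (W.baseChange K).ordinaryLocalKer E' n ↔ s ∈ (W.baseChange K).ordinaryLocalKer E n := by
  refine ⟨fun h ↦ ?_, conjAct_mem_ordinaryLocalKer_of_mem W σ θ hθ n⟩
  have h' := conjAct_mem_ordinaryLocalKer_of_mem (K := K) W σ⁻¹ θ.symm (isSemilinearRingEquiv_symm hθ) n h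
  rwa [conjAct_inv_conjAct] at h'

end Transport

section Completion

variable {K : Type} [Field K] [NumberField K] (W : WeierstrassCurve ℚ)

/-- **The ordinary condition at `v` transports to the ordinary condition at `σ • v`** (Galois transport of
completions `galAdicCompletionEquiv`): `σ_* s ∈ ordinaryLocalKer K_{σ•v} ↔ s ∈ ordinaryLocalKer K_v`. At a
`σ`-FIXED (inert) unipotent-admissible level prime `q` of the method skeleton this is the `τ`-stability of the
level-`n` condition `H¹_ord(K_q, E[3])`. [cite: BertoliniDarmon2005, §2.2 (H¹_ord)] [cite: WZhang2014, §4.1] -/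
theorem conjAct_mem_ordinaryLocalKer_adicCompletion_iff (σ : K ≃ₐ[ℚ] K) {v v' : HeightOneSpectrum (𝓞 K)}
    (h : σ • v = v') (n : ℤ) (s : galH1Torsion (W.baseChange K) n) :
    conjAct W σ n s ∈ (W.baseChange K).ordinaryLocalKer (v'.adicCompletion K) n ↔
      s ∈ (W.baseChange K).ordinaryLocalKer (v.adicCompletion K) n := by
  haveI : CharZero (v.adicCompletion K) := charZero_of_injective_algebraMap (algebraMap K _).injective
  haveI : CharZero (v'.adicCompletion K) := charZero_of_injective_algebraMap (algebraMap K _).injective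
  exact conjAct_mem_ordinaryLocalKer_iff (K := K) W σ (galAdicCompletionEquiv (L := K) σ h)
    (isSemilinearRingEquiv_galAdicCompletionEquiv σ h) n s

end Completion

end Summit.BirchSwinnertonDyer.Rank1Residual.X11b.Three.Koly.ZhangSupply.LocalConj

end
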